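import Literature.Computability.Complexity.OccurrenceObstructionsIPProofs
import Literature.Computability.AlgebraicComplexity.MultiplicityObstructionsProofs
import Literature.NumberTheory.DiophantineGeometry.SchurWeylPlethysmKroneckerBoundProofs
import HarnessLib

/-!
# `ValuativeGCT.ValuativeFlip` (stmt-ValiantsHypothesis-12624): no Kronecker flip on the stable rays
# — size-transfer axis, part II (where the `m → m+1` transfer exists, it transfers nothing)

Crux `ValuativeFlip` of route `ValuativeGCT` (wall-breaker decomposition k12/16, axis "representation-
stability transfer between `m` and `m + 1`", 2026-08-16).  The only det-side transfer from size `m` to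
size `m + 1` available in print is Manivel's rectangular Kronecker stability (IP17 Thm. 2.1, upper half,
in tree as `kroneckerCoeff_rowLift_le`): for a shape `λ ⊢ m·δ` with SMALL BODY `|λ̄| ≤ m`, the
Kronecker majorant `g(λ, m×δ, m×δ)` of the determinant side does not grow along the diagonal ray
`(m + j, λ♯(m+j))`, `λ♯(m+j) = λ + (jδ)` (boxes added to the first row).  This file records, sorry-free,
that on exactly these rays the PERMANENT side is dominated at every position and every inner size, so
the transfer is vacuous for Kronecker-type flips:

* `orbitMultiplicity_paddedPer_le_kroneckerCoeff_of_bodySize_le` — `|λ̄| ≤ m` ⟹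
  `mult_{λ*} ℂ[Δ_m(X₀₀^{m-n} per_n)] ≤ a_λ(δ[m]) ≤ g(λ, m×δ, m×δ)` for every `n ≤ m` (BLMW's plethysm
  bound `orbitMultiplicity_le_plethysmCoeff_holds` + IP17 Prop. 2.8 `ikenmeyerPanova2017_prop_2_8_holds`,
  both PROVED in tree);
* `bodySize_rowLift` — the body is invariant along the ray; hence
* `orbitMultiplicity_paddedPer_rowLift_le_kroneckerCoeff` — for every `j` and every inner size
  `n' ≤ m + j`: `mult_{(λ♯)*} ℂ[Δ_{m+j}(X₀₀^{m+j-n'} per_{n'})] ≤ g(λ♯(m+j), (m+j)×δ, (m+j)×δ) ≤ g(λ, m×δ, m×δ)`;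
* `orbitMultiplicity_det_rowLift_le_kroneckerCoeff` — and the same uniform bound for the determinant's
  own multiplicities `K_{m+j}((λ♯)*)` (BLMW Prop. 5.2.1, `orbitMultiplicity_det_le_kroneckerCoeff_holds`).

So along a stable ray both sides of the would-be Kronecker flip `g < mult_pp` are squeezed under the
single number `g(λ, m×δ, m×δ)`; a flip witness of the crux at `(n, m)` never has `|λ̄| ≤ m` unless it is
a genuinely valuative / symmetric-Kronecker witness (`dim T_U(λ) < mult_pp ≤ g`), for which no
size-`m+1` stability is known.  Consequence for the axis (AXIS.md of the wall-breaker): the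
`m → m+1` transfer of flips is EMPTY in the stable range and UNAVAILABLE outside it.

Sources: C. Ikenmeyer, G. Panova, Adv. Math. 319 (2017) Thm. 2.1, Prop. 2.8; L. Manivel,
J. Algebraic Combin. 33 (2011) Thm. 1; BLMW, SIAM J. Comput. 40 (2011) §4.4, Prop. 5.2.1.
-/

set_option linter.dupNamespace false

namespace Summit.ValiantsHypothesis.ValiantsHypothesis.Theorems.ValuativeFlip

open scoped BigOperators
open Literature.NumberTheory.DiophantineGeometry
open Literature.Computability.AlgebraicComplexity
open Literature.Computability.Complexity

noncomputable section

/-- **No Kronecker flip at a Manivel-stable shape, at any inner size.**  For `n ≤ m` and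
`λ ⊢ m·δ` with at most `m²` parts and `|λ̄| ≤ m`:
`mult_{λ*} ℂ[Δ_m(X₀₀^{m-n} per_n)] ≤ g(λ, m×δ, m×δ)` (plethysm bound, then IP17 Prop. 2.8).
[Ikenmeyer–Panova 2017 Prop. 2.8; BLMW 2011 §4.4] -/
theorem orbitMultiplicity_paddedPer_le_kroneckerCoeff_of_bodySize_le {n m δ : ℕ} [NeZero m]
    (hnm : n ≤ m) (lam : Nat.Partition (m * δ)) (hlam : lam.parts.card ≤ m * m)
    (hbody : bodySize lam ≤ m) :
    orbitMultiplicity ℂ (paddedPerFormLex ℂ n m) m (partitionWeightLex m lam) ≤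
      kroneckerCoeff ℂ lam (Nat.Partition.rectangle m δ) (Nat.Partition.rectangle m δ) :=
  (orbitMultiplicity_le_plethysmCoeff_holds (paddedPerFormLex ℂ n m) (NeZero.ne m)
      (paddedPerFormLex_isHomogeneous ℂ hnm) _).trans
    (ikenmeyerPanova2017_prop_2_8_holds m δ lam hlam hbody)

/-- The largest part of `λ♯(m+j)` is `λ₁ + jδ`. [folklore] -/
theorem sup_parts_rowLift {m δ : ℕ} (lam : Nat.Partition (m * δ)) (j : ℕ) :
    (rowLift lam j).parts.sup = lam.parts.sup + j * δ := by
  rw [sup_parts_eq_getD_sortedParts, getD_sortedParts_rowLift, sup_parts_eq_getD_sortedParts]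
  simp

/-- **The body is invariant along the ray**: `|λ♯(m+j)‾| = |λ̄|`. [folklore] -/
theorem bodySize_rowLift {m δ : ℕ} (lam : Nat.Partition (m * δ)) (j : ℕ) :
    bodySize (rowLift lam j) = bodySize lam := by
  unfold bodySize
  rw [sup_parts_rowLift]
  have h := sup_parts_le lam
  have he : (m + j) * δ = m * δ + j * δ := by ring
  rw [he]
  omega

/-- **The permanent side is dominated along the whole stable ray.**  For `λ ⊢ m·δ` with at most
`m²` parts and `|λ̄| ≤ m`, every `j` and every inner size `n' ≤ m + j`:
`mult_{(λ♯(m+j))*} ℂ[Δ_{m+j}(X₀₀^{m+j-n'} per_{n'})] ≤ g(λ, m×δ, m×δ)` — plethysm bound and IP17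
Prop. 2.8 at size `m + j` (the body of `λ♯` is `|λ̄| ≤ m ≤ m + j`), then Manivel's stability
`g(λ♯(m+j), (m+j)×δ, (m+j)×δ) ≤ g(λ, m×δ, m×δ)` (`kroneckerCoeff_rowLift_le`).  This is the per side
of the `m → m + j` transfer in the one range where the det side has a stability theorem: it is bounded
by the det-side majorant at the BASE of the ray, uniformly in `j` and `n'`.
[Ikenmeyer–Panova 2017 Thm. 2.1, Prop. 2.8; Manivel 2011 Thm. 1; BLMW 2011 §4.4] -/
theorem orbitMultiplicity_paddedPer_rowLift_le_kroneckerCoeff {m δ : ℕ} [NeZero m]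
    (lam : Nat.Partition (m * δ)) (hlam : lam.parts.card ≤ m * m) (hbody : bodySize lam ≤ m)
    (j : ℕ) [NeZero (m + j)] {n' : ℕ} (hn' : n' ≤ m + j) :
    orbitMultiplicity ℂ (paddedPerFormLex ℂ n' (m + j)) (m + j) (partitionWeightLex (m + j) (rowLift lam j)) ≤
      kroneckerCoeff ℂ lam (Nat.Partition.rectangle m δ) (Nat.Partition.rectangle m δ) := by
  have hcard : (rowLift lam j).parts.card ≤ (m + j) * (m + j) :=
    (card_parts_rowLift_le lam j).trans (max_le (hlam.trans (Nat.mul_le_mul (Nat.le_add_right m j)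
      (Nat.le_add_right m j))) (Nat.one_le_iff_ne_zero.2 (mul_ne_zero (NeZero.ne (m + j)) (NeZero.ne (m + j)))))
  have hbody' : bodySize (rowLift lam j) ≤ m + j := by
    rw [bodySize_rowLift]; exact hbody.trans (Nat.le_add_right m j)
  exact (orbitMultiplicity_paddedPer_le_kroneckerCoeff_of_bodySize_le hn' (rowLift lam j) hcard hbody').trans
    (kroneckerCoeff_rowLift_le lam hbody j)

/-- **The determinant's multiplicities are dominated along the stable ray by the same number**:
`K_{m+j}((λ♯(m+j))*) ≤ g(λ♯(m+j), (m+j)×δ, (m+j)×δ) ≤ g(λ, m×δ, m×δ)` for `|λ̄| ≤ m`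
(BLMW Prop. 5.2.1 `orbitMultiplicity_det_le_kroneckerCoeff_holds`, then `kroneckerCoeff_rowLift_le`).
[BLMW 2011 Prop. 5.2.1; Ikenmeyer–Panova 2017 Thm. 2.1] -/
theorem orbitMultiplicity_det_rowLift_le_kroneckerCoeff {m δ : ℕ} [NeZero m]
    (lam : Nat.Partition (m * δ)) (hlam : lam.parts.card ≤ m * m) (hbody : bodySize lam ≤ m) (j : ℕ) :
    orbitMultiplicity ℂ (detFormLex ℂ (m + j)) (m + j) (partitionWeightLex (m + j) (rowLift lam j)) ≤
      kroneckerCoeff ℂ lam (Nat.Partition.rectangle m δ) (Nat.Partition.rectangle m δ) := by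
  haveI : NeZero (m + j) := ⟨by have := NeZero.ne m; omega⟩
  have hcard : (rowLift lam j).parts.card ≤ (m + j) * (m + j) :=
    (card_parts_rowLift_le lam j).trans (max_le (hlam.trans (Nat.mul_le_mul (Nat.le_add_right m j)
      (Nat.le_add_right m j))) (Nat.one_le_iff_ne_zero.2 (mul_ne_zero (NeZero.ne (m + j)) (NeZero.ne (m + j)))))
  exact (orbitMultiplicity_det_le_kroneckerCoeff_holds (k := ℂ) (rowLift lam j) hcard).trans
    (kroneckerCoeff_rowLift_le lam hbody j)

end

end Summit.ValiantsHypothesis.ValiantsHypothesis.Theorems.ValuativeFlip
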